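import Literature.NumberTheory.Sieve.BombieriAsymptoticSieveProofs
import Literature.NumberTheory.LFunctions.MertensSecondLogPower
import HarnessLib

/-!
# Bombieri's asymptotic sieve under the hypotheses of `Literature.NumberTheory.Sieve.bombieri_asymptotic_sieve`: toolkit

Topic `Literature/NumberTheory/Sieve`, companion file of `BombieriAsymptoticSieve.lean` and
`ParityBarrier.lean`. Everything here is PROVED (theorems only, no new definitions, no `sorry`).

`Literature.NumberTheory.Sieve.bombieri_asymptotic_sieve` (`ParityBarrier.lean`) transcribes Bombieri's asymptotic sieve
([BombieriAsymptoticSieve1976]; [FriedlanderIwaniecPisa1978] Theorem 1) with the hypotheses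
`X(x) = x`, `HasSieveDimension g 1 K`, `SieveSequence.HasLinearDensity c`
(`∑_{p≤x} g(p) log p = log x + c + O((log x)^{−B})`), `SieveSequence.HasDensityConstant H`,
level of distribution `x^θ` for every `θ < 1` on SQUAREFREE moduli, and `∑_{n≤x} a_n² ≪ x (log x)^C`,
in place of Bombieri's (A₁)–(A₅) (`SieveSequence.IsBombieriSequence`, under which Theorem 1 is the
tree's `Bombieri1976_asymptotic_sieve_holds`). This file unpacks those hypotheses into the
quantitative inputs of the proof of [FriedlanderIwaniecPisa1978] §4:

* `densityProduct_ge_of_dim`, `densityConstant_pos`, `exists_densityProduct_le`,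
  `eventually_abs_densityProduct_sub_le` — `V(z) = ∏_{p<z}(1 − g(p))` versus `H ∏_{p<z}(1 − 1/p)`
  (the rôle of Lemma 7), `H > 0`;
* `exists_sum_density_log_le`, `eventually_oscillation_le` — consequences of `HasLinearDensity`,
  the second one combined with Mertens' first theorem with the prime number theorem error term
  (`Mertens.abs_mertensTau_sub_const_le`): the sums of `(g(p) − 1/p) log p` over prime-convex sets
  of primes `≥ z` tend to `0` (input of `BombieriAsymptoticSieveOscillation.lean`);
* `level_bound`, `crude_bound`, `sum_le_sqrt_card_mul_sum_sq`, `sum_mul_le_sqrt_mul` — the level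
  of distribution and the second-moment bound, unpacked, and Cauchy–Schwarz;
* `sum_rough_abs_moebius_mul_density_le`, `sum_rough_abs_moebius_div_le` — Lemma 8 for squarefree
  rough `d` from `HasSieveDimension` alone.

## References

* J. Friedlander, H. Iwaniec, *On Bombieri's asymptotic sieve*, Ann. Scuola Norm. Sup. Pisa
  Cl. Sci. (4) 5 (1978), 719–756, Lemmata 7–8. [FriedlanderIwaniecPisa1978]
* E. Bombieri, *The asymptotic sieve*, Rend. Accad. Naz. XL (5) 1/2 (1975/76), 243–269.
  [BombieriAsymptoticSieve1976]
* H. L. Montgomery, R. C. Vaughan, *Multiplicative Number Theory I*, CUP 2007, Thm 2.7 and §6.2.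
  [MontgomeryVaughan2007]
-/

open Filter Finset Asymptotics
open scoped Topology ArithmeticFunction.Moebius

noncomputable section

namespace Literature.NumberTheory.Sieve

namespace BombieriSieve

/-! ### The sifting product `V(z)` under `HasSieveDimension` and `HasDensityConstant` -/

/-- Under `HasSieveDimension g 1 K`: `V(z) = ∏_{p<z} (1 − g(p)) ≥ log 2 / (K log z)` for `z ≥ 2`.
[folklore] -/
theorem densityProduct_ge_of_dim (A : SieveSequence) {K : ℝ} (hK : HasSieveDimension A.density 1 K)
    {z : ℝ} (hz : 2 ≤ z) :
    Real.log 2 / (K * Real.log z) ≤ A.densityProduct (primesProdBelow z) := by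
  have hK1 : 1 ≤ K := hK.one_le
  have hlogz : 0 < Real.log z := Real.log_pos (by linarith)
  have hlog2 : 0 < Real.log 2 := Real.log_pos one_lt_two
  have h := hK.2 2 z le_rfl hz
  rw [Real.rpow_one] at h
  have hfilter : (Nat.primesBelow ⌈z⌉₊).filter (fun p : ℕ => (2 : ℝ) ≤ (p : ℝ)) =
      Nat.primesBelow ⌈z⌉₊ := by
    refine Finset.filter_true_of_mem fun p hp => ?_
    exact_mod_cast (Nat.mem_primesBelow.mp hp).2.two_le
  rw [hfilter, Finset.prod_inv_distrib] at h
  rw [densityProduct_primesProdBelow]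
  have hV0 : 0 < ∏ p ∈ Nat.primesBelow ⌈z⌉₊, (1 - A.density p) :=
    Finset.prod_pos fun p hp => sub_pos.mpr (hK.1 p (Nat.mem_primesBelow.mp hp).2).2
  rw [inv_le_iff_one_le_mul₀' hV0] at h
  rw [div_le_iff₀ (by positivity)]
  calc Real.log 2 = Real.log 2 * 1 := (mul_one _).symm
    _ ≤ Real.log 2 * ((∏ p ∈ Nat.primesBelow ⌈z⌉₊, (1 - A.density p)) *
          (K * (Real.log z / Real.log 2))) := mul_le_mul_of_nonneg_left h hlog2.le
    _ = (∏ p ∈ Nat.primesBelow ⌈z⌉₊, (1 - A.density p)) * (K * Real.log z) := by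
        field_simp

/-- The ratio `V(z)/P(z)`, `P(z) = ∏_{p<z}(1 − 1/p)`, is a term of the sequence defining
`HasDensityConstant`. [folklore] -/
theorem densityProduct_eq_ratio_mul (A : SieveSequence) (z : ℝ) :
    A.densityProduct (primesProdBelow z) =
      (∏ p ∈ Nat.primesLE (⌈z⌉₊ - 1), (1 - A.density p) / (1 - (p : ℝ)⁻¹)) *
        ∏ p ∈ Nat.primesBelow ⌈z⌉₊, (1 - (p : ℝ)⁻¹) := by
  rw [densityProduct_primesProdBelow, ← Nat.primesBelow_eq_primesLE_sub_one, Finset.prod_div_distrib,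
    div_mul_cancel₀]
  refine Finset.prod_ne_zero_iff.mpr fun p hp => ?_
  have hp1 : (1 : ℝ) < p := by exact_mod_cast (Nat.mem_primesBelow.mp hp).2.one_lt
  exact (sub_pos.mpr (inv_lt_one_of_one_lt₀ hp1)).ne'

/-- Under `HasSieveDimension g 1 K` and `HasDensityConstant H`: `H ≥ log 2 / K > 0`. [folklore] -/
theorem densityConstant_pos (A : SieveSequence) {K H : ℝ} (hK : HasSieveDimension A.density 1 K)
    (hH : A.HasDensityConstant H) : Real.log 2 / K ≤ H ∧ 0 < H := by
  have hK1 : 1 ≤ K := hK.one_le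
  have hlog2 : 0 < Real.log 2 := Real.log_pos one_lt_two
  have hpos : 0 < Real.log 2 / K := div_pos hlog2 (by linarith)
  suffices h : Real.log 2 / K ≤ H from ⟨h, hpos.trans_le h⟩
  refine ge_of_tendsto hH (Filter.eventually_atTop.mpr ⟨2, fun N hN => ?_⟩)
  -- at `z = N + 1`: `V(z)/P(z) ≥ (log 2/(K log z)) · log z`
  set z : ℝ := (N : ℝ) + 1 with hz
  have hN2 : (2 : ℝ) ≤ N := by exact_mod_cast hN
  have hz2 : 2 ≤ z := by rw [hz]; linarith
  have hceil : ⌈z⌉₊ = N + 1 := by rw [hz]; exact_mod_cast Nat.ceil_natCast (N + 1)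
  have hV := densityProduct_ge_of_dim A hK hz2
  rw [densityProduct_eq_ratio_mul, hceil, Nat.add_sub_cancel] at hV
  have hP : ∏ p ∈ Nat.primesBelow (N + 1), (1 - (p : ℝ)⁻¹) ≤ 1 / Real.log z := by
    have := prod_primesBelow_one_sub_inv_le (z := z) (by linarith)
    rwa [hceil] at this
  have hP0 : 0 < ∏ p ∈ Nat.primesBelow (N + 1), (1 - (p : ℝ)⁻¹) :=
    Finset.prod_pos fun p hp => sub_pos.mpr (inv_lt_one_of_one_lt₀
      (by exact_mod_cast (Nat.mem_primesBelow.mp hp).2.one_lt))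
  have hlogz : 0 < Real.log z := Real.log_pos (by linarith)
  have hratio0 : 0 ≤ ∏ p ∈ Nat.primesLE N, (1 - A.density p) / (1 - (p : ℝ)⁻¹) :=
    Finset.prod_nonneg fun p hp => div_nonneg
      (sub_nonneg.mpr (hK.1 p (Nat.mem_primesLE.mp hp).2).2.le)
      (sub_nonneg.mpr (inv_le_one_of_one_le₀
        (by exact_mod_cast (Nat.mem_primesLE.mp hp).2.one_lt.le)))
  -- `log 2/(K log z) ≤ ratio · P ≤ ratio / log z`
  have h1 : Real.log 2 / (K * Real.log z) ≤
      (∏ p ∈ Nat.primesLE N, (1 - A.density p) / (1 - (p : ℝ)⁻¹)) * (1 / Real.log z) :=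
    hV.trans (mul_le_mul_of_nonneg_left hP hratio0)
  rw [mul_one_div, div_le_div_iff₀ (by positivity) hlogz] at h1
  have h2 : Real.log 2 * Real.log z ≤
      (∏ p ∈ Nat.primesLE N, (1 - A.density p) / (1 - (p : ℝ)⁻¹)) * K * Real.log z := by
    calc Real.log 2 * Real.log z
        ≤ (∏ p ∈ Nat.primesLE N, (1 - A.density p) / (1 - (p : ℝ)⁻¹)) * (K * Real.log z) := h1
      _ = _ := by ring
  have h3 : Real.log 2 ≤ (∏ p ∈ Nat.primesLE N, (1 - A.density p) / (1 - (p : ℝ)⁻¹)) * K :=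
    le_of_mul_le_mul_right h2 hlogz
  rw [div_le_iff₀ (by linarith)]
  exact h3

/-- Under `HasSieveDimension g 1 K` and `HasDensityConstant H`: `V(z) ≤ C / log z` for all `z ≥ 2`,
for some constant `C` ([FriedlanderIwaniecPisa1978] Lemma 7's "`≪ (log z)^{−1}`", here from the
convergence of `V(z)/P(z) → H` and Mertens' `P(z) ≤ 1/log z`). [cite: FriedlanderIwaniecPisa1978, Lemma 7] -/
theorem exists_densityProduct_le (A : SieveSequence) {H : ℝ} (hH : A.HasDensityConstant H) :
    ∃ C : ℝ, 0 < C ∧ ∀ z : ℝ, 2 ≤ z → A.densityProduct (primesProdBelow z) ≤ C / Real.log z := by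
  -- the convergent sequence of ratios is bounded
  obtain ⟨M, hM⟩ : BddAbove (Set.range fun N : ℕ =>
      ∏ p ∈ Nat.primesLE N, (1 - A.density p) / (1 - (p : ℝ)⁻¹)) := by
    have hH' : Tendsto (fun N : ℕ => ∏ p ∈ Nat.primesLE N, (1 - A.density p) / (1 - (p : ℝ)⁻¹))
        cofinite (𝓝 H) := by
      rw [Nat.cofinite_eq_atTop]; exact hH
    exact hH'.bddAbove_range_of_cofinite
  have hM' : ∀ N : ℕ, ∏ p ∈ Nat.primesLE N, (1 - A.density p) / (1 - (p : ℝ)⁻¹) ≤ M :=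
    fun N => hM ⟨N, rfl⟩
  refine ⟨max M 1, by positivity, fun z hz => ?_⟩
  have hlogz : 0 < Real.log z := Real.log_pos (by linarith)
  rw [densityProduct_eq_ratio_mul]
  have hP : ∏ p ∈ Nat.primesBelow ⌈z⌉₊, (1 - (p : ℝ)⁻¹) ≤ 1 / Real.log z :=
    prod_primesBelow_one_sub_inv_le (by linarith)
  have hP0 : 0 ≤ ∏ p ∈ Nat.primesBelow ⌈z⌉₊, (1 - (p : ℝ)⁻¹) :=
    Finset.prod_nonneg fun p hp => sub_nonneg.mpr (inv_le_one_of_one_le₀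
      (by exact_mod_cast (Nat.mem_primesBelow.mp hp).2.one_lt.le))
  calc (∏ p ∈ Nat.primesLE (⌈z⌉₊ - 1), (1 - A.density p) / (1 - (p : ℝ)⁻¹)) *
        ∏ p ∈ Nat.primesBelow ⌈z⌉₊, (1 - (p : ℝ)⁻¹)
      ≤ max M 1 * (1 / Real.log z) :=
        mul_le_mul ((hM' _).trans (le_max_left _ _)) hP hP0 (by positivity)
    _ = max M 1 / Real.log z := mul_one_div _ _

/-- Two-sided closeness of `V(z)` to `H P(z)`: for every `δ > 0`, for all large `z`,
`|V(z) − H P(z)| ≤ δ P(z) ≤ δ / log z` (from `HasDensityConstant`). [folklore] -/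
theorem eventually_abs_densityProduct_sub_le (A : SieveSequence) {H : ℝ}
    (hH : A.HasDensityConstant H) {δ : ℝ} (hδ : 0 < δ) :
    ∀ᶠ z : ℝ in atTop, |A.densityProduct (primesProdBelow z) -
        H * ∏ p ∈ Nat.primesBelow ⌈z⌉₊, (1 - (p : ℝ)⁻¹)| ≤ δ / Real.log z := by
  have hev := (Metric.tendsto_atTop.mp hH) δ hδ
  obtain ⟨N₀, hN₀⟩ := hev
  filter_upwards [eventually_ge_atTop ((N₀ : ℝ) + 2), eventually_ge_atTop (2 : ℝ)] with z hz hz2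
  have hlogz : 0 < Real.log z := Real.log_pos (by linarith)
  have hN : N₀ ≤ ⌈z⌉₊ - 1 := by
    have h1 : (N₀ : ℝ) + 2 ≤ ⌈z⌉₊ := hz.trans (Nat.le_ceil z)
    have h2 : N₀ + 2 ≤ ⌈z⌉₊ := by exact_mod_cast h1
    omega
  have hd := hN₀ _ hN
  rw [Real.dist_eq] at hd
  have hP : ∏ p ∈ Nat.primesBelow ⌈z⌉₊, (1 - (p : ℝ)⁻¹) ≤ 1 / Real.log z :=
    prod_primesBelow_one_sub_inv_le (by linarith)
  have hP0 : 0 ≤ ∏ p ∈ Nat.primesBelow ⌈z⌉₊, (1 - (p : ℝ)⁻¹) :=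
    Finset.prod_nonneg fun p hp => sub_nonneg.mpr (inv_le_one_of_one_le₀
      (by exact_mod_cast (Nat.mem_primesBelow.mp hp).2.one_lt.le))
  rw [densityProduct_eq_ratio_mul, ← sub_mul, abs_mul, abs_of_nonneg hP0]
  calc |(∏ p ∈ Nat.primesLE (⌈z⌉₊ - 1), (1 - A.density p) / (1 - (p : ℝ)⁻¹)) - H| *
        ∏ p ∈ Nat.primesBelow ⌈z⌉₊, (1 - (p : ℝ)⁻¹)
      ≤ δ * (1 / Real.log z) := mul_le_mul hd.le hP hP0 hδ.le
    _ = δ / Real.log z := mul_one_div _ _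


/-! ### Consequences of `HasLinearDensity` -/

/-- Under `HasLinearDensity` (and `g(p) ≥ 0`): `∑_{p ≤ X} g(p) log p ≤ C log X` for all `X ≥ 2`.
[folklore] -/
theorem exists_sum_density_log_le (A : SieveSequence) {K c : ℝ}
    (hK : HasSieveDimension A.density 1 K) (hlin : A.HasLinearDensity c) :
    ∃ C : ℝ, 0 < C ∧ ∀ X : ℝ, 2 ≤ X →
      ∑ p ∈ Nat.primesLE ⌊X⌋₊, A.density p * Real.log p ≤ C * Real.log X := by
  have h := hlin 1 one_pos
  obtain ⟨C₀, hC₀⟩ := h.bound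
  obtain ⟨X₀, hX₀⟩ := Filter.eventually_atTop.mp hC₀
  set X₁ : ℝ := max X₀ 3 with hX₁
  set M : ℝ := ∑ p ∈ Nat.primesLE ⌊X₁⌋₊, A.density p * Real.log p with hM
  have hterm0 : ∀ p ∈ Nat.primesLE ⌊X₁⌋₊, 0 ≤ A.density p * Real.log p := fun p hp =>
    mul_nonneg (hK.1 p (Nat.mem_primesLE.mp hp).2).1
      (Real.log_nonneg (by exact_mod_cast (Nat.mem_primesLE.mp hp).2.one_lt.le))
  have hM0 : 0 ≤ M := Finset.sum_nonneg hterm0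
  have hlog2 : 0 < Real.log 2 := Real.log_pos one_lt_two
  refine ⟨max (1 + |c| + |C₀|) (M / Real.log 2) + 1, by positivity, fun X hX => ?_⟩
  have hlogX : Real.log 2 ≤ Real.log X := Real.log_le_log two_pos hX
  have hlogX0 : 0 < Real.log X := hlog2.trans_le hlogX
  by_cases hXX : X₁ ≤ X
  · -- large `X`: use the asymptotic
    have hX3 : 3 ≤ X := le_trans (le_max_right _ _) hXX
    have hlogX1 : 1 ≤ Real.log X := by
      rw [← Real.log_exp 1]
      exact Real.log_le_log (Real.exp_pos 1) (le_trans (by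
        have := Real.exp_one_lt_d9; norm_num at this ⊢; linarith) hX3)
    have hb := hX₀ X (le_trans (le_max_left _ _) hXX)
    rw [Real.rpow_one, Real.norm_eq_abs, Real.norm_eq_abs, abs_inv,
      abs_of_pos hlogX0] at hb
    have hb' : |(∑ p ∈ Nat.primesLE ⌊X⌋₊, A.density p * Real.log p) - (Real.log X + c)| ≤ |C₀| := by
      refine hb.trans ?_
      calc C₀ * (Real.log X)⁻¹ ≤ |C₀| * (Real.log X)⁻¹ :=
            mul_le_mul_of_nonneg_right (le_abs_self _) (inv_nonneg.mpr hlogX0.le)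
        _ ≤ |C₀| * 1 := mul_le_mul_of_nonneg_left (inv_le_one_of_one_le₀ hlogX1) (abs_nonneg _)
        _ = |C₀| := mul_one _
    have h1 : ∑ p ∈ Nat.primesLE ⌊X⌋₊, A.density p * Real.log p ≤ Real.log X + |c| + |C₀| := by
      have := (abs_le.mp hb').2
      linarith [le_abs_self c]
    calc ∑ p ∈ Nat.primesLE ⌊X⌋₊, A.density p * Real.log p ≤ Real.log X + |c| + |C₀| := h1
      _ ≤ (1 + |c| + |C₀|) * Real.log X := by nlinarith [abs_nonneg c, abs_nonneg C₀]
      _ ≤ (max (1 + |c| + |C₀|) (M / Real.log 2) + 1) * Real.log X :=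
          mul_le_mul_of_nonneg_right
            (by linarith [le_max_left (1 + |c| + |C₀|) (M / Real.log 2)]) hlogX0.le
  · -- small `X`: monotonicity
    push Not at hXX
    have hsub : Nat.primesLE ⌊X⌋₊ ⊆ Nat.primesLE ⌊X₁⌋₊ := by
      intro p hp
      rw [Nat.mem_primesLE] at hp ⊢
      exact ⟨hp.1.trans (Nat.floor_le_floor hXX.le), hp.2⟩
    have h1 : ∑ p ∈ Nat.primesLE ⌊X⌋₊, A.density p * Real.log p ≤ M :=
      Finset.sum_le_sum_of_subset_of_nonneg hsub fun p hp _ => hterm0 p hp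
    calc ∑ p ∈ Nat.primesLE ⌊X⌋₊, A.density p * Real.log p ≤ M := h1
      _ = (M / Real.log 2) * Real.log 2 := by field_simp
      _ ≤ (M / Real.log 2) * Real.log X := mul_le_mul_of_nonneg_left hlogX (by positivity)
      _ ≤ (max (1 + |c| + |C₀|) (M / Real.log 2) + 1) * Real.log X :=
          mul_le_mul_of_nonneg_right
            (by linarith [le_max_right (1 + |c| + |C₀|) (M / Real.log 2)]) hlogX0.le

/-- Sum over a prime-convex set of primes as a difference of two complete sums. [folklore] -/
theorem sum_primeConvex_eq_sub (f : ℕ → ℝ) {I : Finset ℕ} (hI : ∀ p ∈ I, p.Prime)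
    (hconv : ∀ p₁ ∈ I, ∀ p₃ ∈ I, ∀ p₂ : ℕ, p₂.Prime → p₁ ≤ p₂ → p₂ ≤ p₃ → p₂ ∈ I)
    (hne : I.Nonempty) :
    ∑ p ∈ I, f p = ∑ p ∈ Nat.primesLE (I.max' hne), f p -
      ∑ p ∈ Nat.primesLE (I.min' hne - 1), f p := by
  have hsub : Nat.primesLE (I.min' hne - 1) ⊆ Nat.primesLE (I.max' hne) := by
    intro p hp
    rw [Nat.mem_primesLE] at hp ⊢
    exact ⟨hp.1.trans ((Nat.sub_le _ _).trans (Finset.min'_le_max' I hne)), hp.2⟩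
  rw [← Finset.sum_sdiff_eq_sub hsub]
  congr 1
  ext p
  rw [Finset.mem_sdiff, Nat.mem_primesLE, Nat.mem_primesLE]
  constructor
  · intro hp
    have h1 := Finset.le_max' I p hp
    have h2 := Finset.min'_le I p hp
    have h3 := (hI _ (Finset.min'_mem I hne)).pos
    exact ⟨⟨h1, hI p hp⟩, fun h => by omega⟩
  · rintro ⟨⟨h1, hp⟩, h2⟩
    refine hconv _ (Finset.min'_mem I hne) _ (Finset.max'_mem I hne) p hp ?_ h1
    by_contra h
    exact h2 ⟨by omega, hp⟩

/-- **Oscillation of `g(p) − 1/p` along the primes** under `HasLinearDensity`: for every `δ > 0`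
and all large `z`, every sum of `(g(p) − 1/p) log p` over a prime-convex set of primes `≥ z` is
at most `δ` in absolute value. From `∑_{p≤t} g(p) log p = log t + c + O(1/log t)`
(`HasLinearDensity`) and Mertens' first theorem with the prime number theorem error term
`∑_{p≤t} log p/p = log t + E + O(1/log t)` (`Mertens.abs_mertensTau_sub_const_le`), the partial
sums `D(t) = ∑_{p≤t} (g(p) − 1/p) log p` satisfy `|D(t) − D_∞| ≪ 1/log t`, and a sum over the
primes in `[p₁, p₃]` is `D(p₃) − D(p₁ − 1)`. [folklore] -/
theorem eventually_oscillation_le (A : SieveSequence) {c : ℝ} (hlin : A.HasLinearDensity c)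
    {δ : ℝ} (hδ : 0 < δ) :
    ∀ᶠ z : ℝ in atTop, ∀ I : Finset ℕ, (∀ p ∈ I, p.Prime ∧ z ≤ (p : ℝ)) →
      (∀ p₁ ∈ I, ∀ p₃ ∈ I, ∀ p₂ : ℕ, p₂.Prime → p₁ ≤ p₂ → p₂ ≤ p₃ → p₂ ∈ I) →
        |∑ p ∈ I, (A.density p - (p : ℝ)⁻¹) * Real.log p| ≤ δ := by
  -- the two asymptotics
  obtain ⟨C₀, hC₀⟩ := (hlin 1 one_pos).bound
  obtain ⟨T₁, hT₁⟩ := Filter.eventually_atTop.mp hC₀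
  obtain ⟨K₁, hK₁⟩ := LFunctions.Mertens.abs_mertensTau_sub_const_le 1
  set E : ℝ := 1 - Real.log 2 + ∫ t in Set.Ioi 2, (Chebyshev.theta t - t) / t ^ 2 with hE
  set D : ℝ → ℝ := fun t => ∑ p ∈ Nat.primesLE ⌊t⌋₊, (A.density p - (p : ℝ)⁻¹) * Real.log p
    with hD
  set M : ℝ := |C₀| + K₁ with hM
  have hK₁0 : 0 ≤ K₁ := by
    have h := hK₁ 2 le_rfl
    have : 0 ≤ K₁ / Real.log 2 ^ 1 := le_trans (abs_nonneg _) h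
    rw [pow_one] at this
    exact (div_nonneg_iff.mp this).elim (fun h => h.1) fun h =>
      absurd h.2 (not_le.mpr (Real.log_pos one_lt_two))
  have hM0 : 0 ≤ M := by positivity
  -- `|D(t) − (c − E)| ≤ M / log t` for `t ≥ max T₁ 2`
  have hkey : ∀ t : ℝ, max T₁ 2 ≤ t → |D t - (c - E)| ≤ M / Real.log t := by
    intro t ht
    have ht2 : 2 ≤ t := le_trans (le_max_right _ _) ht
    have hlogt : 0 < Real.log t := Real.log_pos (by linarith)
    have h1 := hT₁ t (le_trans (le_max_left _ _) ht)
    rw [Real.rpow_one, Real.norm_eq_abs, Real.norm_eq_abs, abs_inv, abs_of_pos hlogt] at h1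
    have h2 := hK₁ t ht2
    rw [pow_one] at h2
    have hDt : D t = (∑ p ∈ Nat.primesLE ⌊t⌋₊, A.density p * Real.log p) -
        LFunctions.Mertens.primeLogDivSum t := by
      rw [hD, LFunctions.Mertens.primeLogDivSum]
      simp only
      rw [← Finset.sum_sub_distrib]
      refine Finset.sum_congr rfl fun p _ => ?_
      rw [sub_mul, div_eq_mul_inv, mul_comm (Real.log p)]
    have hsplit : D t - (c - E) =
        ((∑ p ∈ Nat.primesLE ⌊t⌋₊, A.density p * Real.log p) - (Real.log t + c)) -
          (LFunctions.Mertens.mertensTau t - E) := by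
      rw [hDt, LFunctions.Mertens.mertensTau]; ring
    rw [hsplit]
    calc |((∑ p ∈ Nat.primesLE ⌊t⌋₊, A.density p * Real.log p) - (Real.log t + c)) -
          (LFunctions.Mertens.mertensTau t - E)|
        ≤ |(∑ p ∈ Nat.primesLE ⌊t⌋₊, A.density p * Real.log p) - (Real.log t + c)| +
            |LFunctions.Mertens.mertensTau t - E| := abs_sub _ _
      _ ≤ C₀ * (Real.log t)⁻¹ + K₁ / Real.log t := add_le_add h1 h2
      _ ≤ |C₀| * (Real.log t)⁻¹ + K₁ / Real.log t := by
          gcongr; exact le_abs_self _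
      _ = M / Real.log t := by rw [hM]; field_simp
  -- choose `z` large
  have hlim : Tendsto (fun z : ℝ => Real.log (z - 1)) atTop atTop :=
    Real.tendsto_log_atTop.comp (tendsto_atTop_add_const_right _ (-1) tendsto_id)
  filter_upwards [eventually_ge_atTop (max T₁ 2 + 2), hlim.eventually_ge_atTop (2 * M / δ + 1)]
    with z hz hzlog I hI hconv
  rcases I.eq_empty_or_nonempty with rfl | hne
  · simp [hδ.le]
  have hz3 : 3 < z := by linarith [le_max_right T₁ 2]
  set p₁ := I.min' hne with hp₁
  set p₃ := I.max' hne with hp₃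
  have hp₁mem : p₁ ∈ I := Finset.min'_mem I hne
  have hp₃mem : p₃ ∈ I := Finset.max'_mem I hne
  have hzp₁ : z ≤ (p₁ : ℝ) := (hI _ hp₁mem).2
  have hzp₃ : z ≤ (p₃ : ℝ) := (hI _ hp₃mem).2
  have hp₁2 : 2 ≤ p₁ := (hI _ hp₁mem).1.two_le
  rw [sum_primeConvex_eq_sub _ (fun p hp => (hI p hp).1) hconv hne]
  -- both complete sums are close to `c − E`
  have hcast₁ : (((p₁ - 1 : ℕ) : ℝ)) = (p₁ : ℝ) - 1 := by
    rw [Nat.cast_sub (by omega), Nat.cast_one]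
  have ht₃ : max T₁ 2 ≤ (p₃ : ℝ) := by linarith
  have ht₁ : max T₁ 2 ≤ ((p₁ - 1 : ℕ) : ℝ) := by rw [hcast₁]; linarith
  have hD₃ : D p₃ = ∑ p ∈ Nat.primesLE p₃, (A.density p - (p : ℝ)⁻¹) * Real.log p := by
    rw [hD]; simp only; rw [Nat.floor_natCast]
  have hD₁ : D ((p₁ - 1 : ℕ) : ℝ) =
      ∑ p ∈ Nat.primesLE (p₁ - 1), (A.density p - (p : ℝ)⁻¹) * Real.log p := by
    rw [hD]; simp only; rw [Nat.floor_natCast]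
  have h3 := hkey _ ht₃
  have h1 := hkey _ ht₁
  rw [hD₃] at h3
  rw [hD₁] at h1
  have hlogz1 : 0 < Real.log (z - 1) := Real.log_pos (by linarith)
  have hlog₃ : Real.log (z - 1) ≤ Real.log (p₃ : ℝ) := Real.log_le_log (by linarith) (by linarith)
  have hlog₁ : Real.log (z - 1) ≤ Real.log ((p₁ - 1 : ℕ) : ℝ) := by
    rw [hcast₁]; exact Real.log_le_log (by linarith) (by linarith)
  have hb₃ : M / Real.log (p₃ : ℝ) ≤ M / Real.log (z - 1) :=
    div_le_div_of_nonneg_left hM0 hlogz1 hlog₃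
  have hb₁ : M / Real.log ((p₁ - 1 : ℕ) : ℝ) ≤ M / Real.log (z - 1) :=
    div_le_div_of_nonneg_left hM0 hlogz1 hlog₁
  have hfin : 2 * (M / Real.log (z - 1)) ≤ δ := by
    rw [mul_div_assoc', div_le_iff₀ hlogz1]
    have : 2 * M / δ ≤ Real.log (z - 1) := by linarith
    rw [div_le_iff₀ hδ] at this
    linarith
  calc |(∑ p ∈ Nat.primesLE p₃, (A.density p - (p : ℝ)⁻¹) * Real.log p) -
        ∑ p ∈ Nat.primesLE (p₁ - 1), (A.density p - (p : ℝ)⁻¹) * Real.log p|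
      = |((∑ p ∈ Nat.primesLE p₃, (A.density p - (p : ℝ)⁻¹) * Real.log p) - (c - E)) -
          ((∑ p ∈ Nat.primesLE (p₁ - 1), (A.density p - (p : ℝ)⁻¹) * Real.log p) - (c - E))| := by
        ring_nf
    _ ≤ |(∑ p ∈ Nat.primesLE p₃, (A.density p - (p : ℝ)⁻¹) * Real.log p) - (c - E)| +
          |(∑ p ∈ Nat.primesLE (p₁ - 1), (A.density p - (p : ℝ)⁻¹) * Real.log p) - (c - E)| :=
        abs_sub _ _
    _ ≤ M / Real.log (z - 1) + M / Real.log (z - 1) := add_le_add (h3.trans hb₃) (h1.trans hb₁)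
    _ = 2 * (M / Real.log (z - 1)) := by ring
    _ ≤ δ := hfin


/-! ### Level of distribution and the crude second-moment bound, unpacked -/

/-- Level of distribution `x^θ` for every `θ < 1` (size `X(x) = x`), unpacked: for every `ε > 0`
and every real `B` there is `C` with `∑_{q ≤ x^{1−ε}, q squarefree} |R_q(x)| ≤ C x/(log x)^B` for
all large `x`. [folklore] -/
theorem level_bound (A : SieveSequence) (hsize : ∀ x, A.size x = x)
    (hlevel : ∀ θ : ℝ, θ < 1 → HasLevelOfDistribution A θ) {ε : ℝ} (hε : 0 < ε) (B : ℝ) :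
    ∃ C : ℝ, 0 < C ∧ ∀ᶠ x : ℝ in atTop,
      ∑ q ∈ (Icc 1 ⌊x ^ (1 - ε)⌋₊).filter Squarefree, |A.remainder q x| ≤
        C * x / Real.log x ^ B := by
  have hL := hlevel (1 - ε / 2) (by linarith) (ε / 2) (by positivity) (max B 1) (by positivity)
  obtain ⟨C, hC⟩ := hL.bound
  refine ⟨max C 1, by positivity, ?_⟩
  filter_upwards [hC, eventually_ge_atTop (3 : ℝ)] with x hx hx3
  have hx0 : 0 < x := by linarith
  have hlog1 : 1 ≤ Real.log x := by
    rw [← Real.log_exp 1]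
    exact Real.log_le_log (Real.exp_pos 1) (le_trans (by
      have := Real.exp_one_lt_d9; norm_num at this ⊢; linarith) hx3)
  have hlog0 : 0 < Real.log x := by linarith
  have hexp : (1 - ε / 2 - ε / 2 : ℝ) = 1 - ε := by ring
  rw [hexp, hsize, Real.norm_eq_abs, Real.norm_eq_abs,
    abs_of_nonneg (Finset.sum_nonneg fun q _ => abs_nonneg _),
    abs_of_nonneg (div_nonneg hx0.le (Real.rpow_nonneg hlog0.le _))] at hx
  refine hx.trans ?_
  rw [mul_div_assoc]
  refine mul_le_mul (le_max_left _ _) ?_ (div_nonneg hx0.le (Real.rpow_nonneg hlog0.le _))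
    (by positivity)
  exact div_le_div_of_nonneg_left hx0.le (Real.rpow_pos_of_pos hlog0 _)
    (Real.rpow_le_rpow_of_exponent_le hlog1 (le_max_left _ _))

/-- The crude bound `∑_{n ≤ x} a_n² ≪ x (log x)^C`, unpacked with a nonnegative exponent and valid
for all `t ≥ 2`. [folklore] -/
theorem crude_bound (A : SieveSequence)
    (hcrude : ∃ C : ℝ, (fun x : ℝ => ∑ n ∈ Ioc 0 ⌊x⌋₊, A.a n ^ 2) =O[atTop]
      fun x : ℝ => x * Real.log x ^ C) :
    ∃ C : ℝ, 0 ≤ C ∧ ∃ K : ℝ, 0 < K ∧ ∀ t : ℝ, 2 ≤ t →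
      ∑ n ∈ Ioc 0 ⌊t⌋₊, A.a n ^ 2 ≤ K * t * Real.log t ^ C := by
  obtain ⟨C, hC⟩ := hcrude
  obtain ⟨K₀, hK₀⟩ := hC.bound
  obtain ⟨T₀, hT₀⟩ := Filter.eventually_atTop.mp hK₀
  set C' := max C 0 with hC'
  set T₁ : ℝ := max T₀ 3 with hT₁
  set M : ℝ := ∑ n ∈ Ioc 0 ⌊T₁⌋₊, A.a n ^ 2 with hM
  have hM0 : 0 ≤ M := Finset.sum_nonneg fun n _ => sq_nonneg _
  have hlog2 : 0 < Real.log 2 := Real.log_pos one_lt_two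
  have hden : 0 < 2 * Real.log 2 ^ C' := by positivity
  refine ⟨C', le_max_right _ _, |K₀| + M / (2 * Real.log 2 ^ C') + 1, by positivity,
    fun t ht => ?_⟩
  have ht0 : 0 < t := by linarith
  have hlogt : Real.log 2 ≤ Real.log t := Real.log_le_log two_pos ht
  have hlogt0 : 0 < Real.log t := hlog2.trans_le hlogt
  have hW : 2 * Real.log 2 ^ C' ≤ t * Real.log t ^ C' :=
    mul_le_mul ht (Real.rpow_le_rpow hlog2.le hlogt (le_max_right _ _))
      (Real.rpow_nonneg hlog2.le _) ht0.le
  have hW0 : 0 < t * Real.log t ^ C' := hden.trans_le hW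
  by_cases htt : T₁ ≤ t
  · have ht3 : 3 ≤ t := le_trans (le_max_right _ _) htt
    have hlog1 : 1 ≤ Real.log t := by
      rw [← Real.log_exp 1]
      exact Real.log_le_log (Real.exp_pos 1) (le_trans (by
        have := Real.exp_one_lt_d9; norm_num at this ⊢; linarith) ht3)
    have hb := hT₀ t (le_trans (le_max_left _ _) htt)
    rw [Real.norm_eq_abs, Real.norm_eq_abs, abs_of_nonneg (Finset.sum_nonneg fun n _ => sq_nonneg _)]
      at hb
    have h1 : |t * Real.log t ^ C| ≤ t * Real.log t ^ C' := by
      rw [abs_of_nonneg (mul_nonneg ht0.le (Real.rpow_nonneg hlogt0.le _))]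
      exact mul_le_mul_of_nonneg_left
        (Real.rpow_le_rpow_of_exponent_le hlog1 (le_max_left _ _)) ht0.le
    calc ∑ n ∈ Ioc 0 ⌊t⌋₊, A.a n ^ 2 ≤ K₀ * |t * Real.log t ^ C| := hb
      _ ≤ |K₀| * |t * Real.log t ^ C| :=
          mul_le_mul_of_nonneg_right (le_abs_self _) (abs_nonneg _)
      _ ≤ |K₀| * (t * Real.log t ^ C') := mul_le_mul_of_nonneg_left h1 (abs_nonneg _)
      _ ≤ (|K₀| + M / (2 * Real.log 2 ^ C') + 1) * (t * Real.log t ^ C') := by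
          refine mul_le_mul_of_nonneg_right ?_ hW0.le
          linarith [div_nonneg hM0 hden.le]
      _ = _ := by ring
  · push Not at htt
    have hsub : Ioc 0 ⌊t⌋₊ ⊆ Ioc 0 ⌊T₁⌋₊ := by
      intro n hn
      rw [Finset.mem_Ioc] at hn ⊢
      exact ⟨hn.1, hn.2.trans (Nat.floor_le_floor htt.le)⟩
    have h1 : ∑ n ∈ Ioc 0 ⌊t⌋₊, A.a n ^ 2 ≤ M :=
      Finset.sum_le_sum_of_subset_of_nonneg hsub fun n _ _ => sq_nonneg _
    calc ∑ n ∈ Ioc 0 ⌊t⌋₊, A.a n ^ 2 ≤ M := h1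
      _ = M / (2 * Real.log 2 ^ C') * (2 * Real.log 2 ^ C') := by field_simp
      _ ≤ M / (2 * Real.log 2 ^ C') * (t * Real.log t ^ C') :=
          mul_le_mul_of_nonneg_left hW (div_nonneg hM0 hden.le)
      _ ≤ (|K₀| + M / (2 * Real.log 2 ^ C') + 1) * (t * Real.log t ^ C') := by
          refine mul_le_mul_of_nonneg_right ?_ hW0.le
          linarith [abs_nonneg K₀]
      _ = _ := by ring

/-- Cauchy–Schwarz: the mass of a nonnegative sequence on a set `S ⊆ (0, N]` is at most
`√(#S · ∑_{n ≤ N} a_n²)`. [folklore] -/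
theorem sum_le_sqrt_card_mul_sum_sq (a : ℕ → ℝ) (ha : ∀ n, 0 ≤ a n) {S : Finset ℕ} {N : ℕ}
    (hS : S ⊆ Ioc 0 N) :
    ∑ n ∈ S, a n ≤ Real.sqrt ((S.card : ℝ) * ∑ n ∈ Ioc 0 N, a n ^ 2) := by
  have hcs := Finset.sum_mul_sq_le_sq_mul_sq S (fun _ => (1 : ℝ)) a
  simp only [one_mul, one_pow, Finset.sum_const, nsmul_eq_mul, mul_one] at hcs
  have h2 : ∑ n ∈ S, a n ^ 2 ≤ ∑ n ∈ Ioc 0 N, a n ^ 2 :=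
    Finset.sum_le_sum_of_subset_of_nonneg hS fun n _ _ => sq_nonneg _
  have h0 : 0 ≤ ∑ n ∈ S, a n := Finset.sum_nonneg fun n _ => ha n
  refine Real.le_sqrt_of_sq_le ?_
  exact hcs.trans (mul_le_mul_of_nonneg_left h2 (Nat.cast_nonneg _))

/-- Cauchy–Schwarz: `∑_{n ≤ N} a_n w_n ≤ √((∑ a_n²)(∑ w_n²))`. [folklore] -/
theorem sum_mul_le_sqrt_mul (a w : ℕ → ℝ) (N : ℕ) :
    ∑ n ∈ Ioc 0 N, a n * w n ≤
      Real.sqrt ((∑ n ∈ Ioc 0 N, a n ^ 2) * ∑ n ∈ Ioc 0 N, w n ^ 2) := by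
  refine Real.le_sqrt_of_sq_le ?_
  exact Finset.sum_mul_sq_le_sq_mul_sq (Ioc 0 N) a w

/-! ### Sums over rough squarefree numbers -/

/-- Under `HasSieveDimension g 1 K`: `∏_{z ≤ p ≤ x} (1 − g(p))⁻¹ ≤ 2K log x / log z` for
`2 ≤ z ≤ x`. [folklore] -/
theorem prod_primesGe_inv_one_sub_density_le (A : SieveSequence) {K : ℝ}
    (hK : HasSieveDimension A.density 1 K) {z x : ℝ} (hz : 2 ≤ z) (hzx : z ≤ x) :
    ∏ p ∈ (Nat.primesLE ⌊x⌋₊).filter (fun p : ℕ => z ≤ (p : ℝ)), (1 - A.density p)⁻¹ ≤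
      2 * K * Real.log x / Real.log z := by
  have hK1 : 1 ≤ K := hK.one_le
  have hx0 : 0 < x := by linarith
  have hlogz : 0 < Real.log z := Real.log_pos (by linarith)
  have hlogx : 0 < Real.log x := Real.log_pos (by linarith)
  set N := ⌊x⌋₊ with hN
  have hNx : (N : ℝ) ≤ x := Nat.floor_le hx0.le
  have hzN1 : z ≤ (N : ℝ) + 1 := by
    have := Nat.lt_floor_add_one x
    rw [← hN] at this; linarith
  have h := hK.2 z ((N : ℝ) + 1) hz hzN1
  rw [Real.rpow_one] at h
  have hceil : ⌈(N : ℝ) + 1⌉₊ = N + 1 := by exact_mod_cast Nat.ceil_natCast (N + 1)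
  rw [hceil, Nat.primesBelow_eq_primesLE_sub_one, Nat.add_sub_cancel] at h
  refine h.trans ?_
  have hlogN : Real.log ((N : ℝ) + 1) ≤ 2 * Real.log x := by
    have h1 : (N : ℝ) + 1 ≤ x ^ 2 := by nlinarith
    calc Real.log ((N : ℝ) + 1) ≤ Real.log (x ^ 2) := Real.log_le_log (by positivity) h1
      _ = 2 * Real.log x := by rw [Real.log_pow]; norm_num
  have h2 : Real.log ((N : ℝ) + 1) / Real.log z ≤ 2 * Real.log x / Real.log z :=
    div_le_div_of_nonneg_right hlogN hlogz.le
  calc K * (Real.log ((N : ℝ) + 1) / Real.log z) ≤ K * (2 * Real.log x / Real.log z) :=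
        mul_le_mul_of_nonneg_left h2 (by linarith)
    _ = 2 * K * Real.log x / Real.log z := by ring

/-- `∑_{d ≤ x, (d,P(z))=1} |μ(d)| g(d) ≤ ∏_{z ≤ p ≤ x} (1 + g(p)) ≤ 2K log x/log z` for
`2 ≤ z ≤ x` ([FriedlanderIwaniecPisa1978] Lemma 8, squarefree terms, from `HasSieveDimension`
alone). [cite: FriedlanderIwaniecPisa1978, Lemma 8] -/
theorem sum_rough_abs_moebius_mul_density_le (A : SieveSequence) {K : ℝ}
    (hK : HasSieveDimension A.density 1 K) {z x : ℝ} (hz : 2 ≤ z) (hzx : z ≤ x) :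
    ∑ d ∈ (Ioc 0 ⌊x⌋₊).filter (fun d : ℕ => d.Coprime (primesProdBelow z)),
        |(μ d : ℝ)| * A.density d ≤ 2 * K * Real.log x / Real.log z := by
  set h : ℕ → ℝ := fun n => |(μ n : ℝ)| * A.density n with hh
  have hg := A.density_mult
  -- `h` is multiplicative, nonnegative, supported on squarefree numbers
  have h1 : h 1 = 1 := by rw [hh]; simp [hg.map_one]
  have hmul : ∀ {m n : ℕ}, Nat.Coprime m n → h (m * n) = h m * h n := by
    intro m n hmn
    rw [hh]; simp only
    rw [ArithmeticFunction.isMultiplicative_moebius.map_mul_of_coprime hmn,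
      hg.map_mul_of_coprime hmn]
    push_cast
    rw [abs_mul]; ring
  have h0 : ∀ n, 0 ≤ h n := by
    intro n
    rw [hh]; simp only
    by_cases hn : Squarefree n
    · refine mul_nonneg (abs_nonneg _) ?_
      rw [BetaSieve.map_eq_prod_primeFactors hg hn]
      exact Finset.prod_nonneg fun p hp => (hK.1 p (Nat.prime_of_mem_primeFactors hp)).1
    · rw [ArithmeticFunction.moebius_eq_zero_of_not_squarefree hn]; simp
  have hpow : ∀ {p : ℕ}, p.Prime → ∀ e : ℕ, h (p ^ e) = if e = 0 then 1 else if e = 1 then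
      A.density p else 0 := by
    intro p hp e
    rcases e with _ | _ | e
    · simp [h1]
    · rw [hh]; simp [ArithmeticFunction.moebius_apply_prime hp]
    · have hns : ¬ Squarefree (p ^ (e + 2)) := by
        rw [Nat.squarefree_pow_iff hp.ne_one (by omega)]
        exact fun h => by omega
      rw [hh]; simp only
      rw [ArithmeticFunction.moebius_eq_zero_of_not_squarefree hns]
      simp
  have hsum : ∀ {p : ℕ}, p.Prime → Summable (fun e : ℕ => h (p ^ e)) := by
    intro p hp
    refine summable_of_ne_finset_zero (s := {0, 1}) fun e he => ?_
    rw [Finset.mem_insert, Finset.mem_singleton, not_or] at he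
    rw [hpow hp e, if_neg he.1, if_neg he.2]
  have htsum : ∀ {p : ℕ}, p.Prime → ∑' e : ℕ, h (p ^ e) = 1 + A.density p := by
    intro p hp
    rw [tsum_eq_sum (s := {0, 1}) (fun e he => by
      rw [Finset.mem_insert, Finset.mem_singleton, not_or] at he
      rw [hpow hp e, if_neg he.1, if_neg he.2]), Finset.sum_pair (by norm_num), hpow hp 0,
      hpow hp 1]
    simp
  calc ∑ d ∈ (Ioc 0 ⌊x⌋₊).filter (fun d : ℕ => d.Coprime (primesProdBelow z)),
        |(μ d : ℝ)| * A.density d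
      ≤ ∏ p ∈ (Nat.primesLE ⌊x⌋₊).filter (fun p : ℕ => z ≤ (p : ℝ)), ∑' e : ℕ, h (p ^ e) :=
        sum_le_prod_tsum_of_factored h1 hmul h0 hsum (fun p hp => (mem_primesGe.mp hp).1)
          (fun d hd => mem_factoredNumbers_of_rough hd)
    _ = ∏ p ∈ (Nat.primesLE ⌊x⌋₊).filter (fun p : ℕ => z ≤ (p : ℝ)), (1 + A.density p) :=
        Finset.prod_congr rfl fun p hp => htsum (mem_primesGe.mp hp).1
    _ ≤ ∏ p ∈ (Nat.primesLE ⌊x⌋₊).filter (fun p : ℕ => z ≤ (p : ℝ)), (1 - A.density p)⁻¹ := by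
        refine Finset.prod_le_prod (fun p hp => ?_) fun p hp => ?_
        · exact add_nonneg zero_le_one (hK.1 p (mem_primesGe.mp hp).1).1
        · obtain ⟨hg0, hg1⟩ := hK.1 p (mem_primesGe.mp hp).1
          rw [← one_div, le_div_iff₀ (by linarith)]
          nlinarith
    _ ≤ 2 * K * Real.log x / Real.log z := prod_primesGe_inv_one_sub_density_le A hK hz hzx

/-- `∑_{d ≤ x, (d,P(z))=1} |μ(d)|/d ≤ e⁵ log x / log z` for `2 ≤ z ≤ x`. [folklore] -/
theorem sum_rough_abs_moebius_div_le {z x : ℝ} (hz : 2 ≤ z) (hzx : z ≤ x) :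
    ∑ d ∈ (Ioc 0 ⌊x⌋₊).filter (fun d : ℕ => d.Coprime (primesProdBelow z)),
        |(μ d : ℝ)| * (d : ℝ)⁻¹ ≤ Real.exp 5 * Real.log x / Real.log z := by
  refine le_trans (Finset.sum_le_sum fun d _ => ?_) (sum_inv_rough_le hz hzx)
  have hμ : |(μ d : ℝ)| ≤ 1 := by
    have := ArithmeticFunction.abs_moebius_le_one (n := d)
    exact_mod_cast this
  calc |(μ d : ℝ)| * (d : ℝ)⁻¹ ≤ 1 * (d : ℝ)⁻¹ :=
        mul_le_mul_of_nonneg_right hμ (inv_nonneg.mpr (Nat.cast_nonneg _))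
    _ = (d : ℝ)⁻¹ := one_mul _

/-- The index set of `mainTermF`, `(Ico 1 ⌈y⌉₊).filter (Coprime · P(z))`, is contained in the
rough numbers `≤ x` when `y ≤ x`. [folklore] -/
theorem Ico_ceil_filter_subset {x y z : ℝ} (hyx : y ≤ x) :
    (Ico 1 ⌈y⌉₊).filter (fun d : ℕ => d.Coprime (primesProdBelow z)) ⊆
      (Ioc 0 ⌊x⌋₊).filter (fun d : ℕ => d.Coprime (primesProdBelow z)) := by
  intro d hd
  rw [Finset.mem_filter, Finset.mem_Ico] at hd
  rw [Finset.mem_filter, Finset.mem_Ioc]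
  refine ⟨⟨hd.1.1, ?_⟩, hd.2⟩
  have h1 : (d : ℝ) < y := by
    have h2 : d + 1 ≤ ⌈y⌉₊ := hd.1.2
    by_contra h
    push Not at h
    have : (⌈y⌉₊ : ℝ) < y + 1 := Nat.ceil_lt_add_one (by
      by_contra hy; push Not at hy
      have : ⌈y⌉₊ = 0 := Nat.ceil_eq_zero.mpr hy.le
      omega)
    have h3 : ((d + 1 : ℕ) : ℝ) ≤ ⌈y⌉₊ := by exact_mod_cast h2
    push_cast at h3
    linarith
  exact Nat.le_floor (h1.le.trans hyx)

end BombieriSieve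

end Literature.NumberTheory.Sieve
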